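import Literature.Topology.FourManifolds.SurgeryGlueData
import HarnessLib

/-!
# Cutting a tube piece of a reconstruction datum in the middle

First cutting step of the reconstruction of a manifold from the pieces of the Ricci flow with
surgery (R. Hamilton, *Four-manifolds with positive isotropic curvature*, Comm. Anal. Geom. 5
(1997), §1.1 pp. 3–4; `SurgeryGlueData.lean`): a tube piece `ι (𝕊ⁿ × (0,1))` of a reconstruction
datum `G` of `Q` over `M'` is cut along its **middle neck** `ψ (θ, τ) = ι (θ, 1/2 + τ)`. For any
side `D` of `ψ` (`NeckCapData`; when `Q` is simply connected such sides exist,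
`exists_neckCapData_of_simplyConnected`), every other piece lies, together with its collar data
(its *footprint*, which is connected and misses the middle sphere), either inside `D` or outside
it (`foot_subset_or_disjoint`); the **upper cut** `SurgeryGlueData.upperCut` is the
reconstruction datum of `D.Capped` made of the pieces inside `D`, transported, and of the capped
half-tube, which is a *ball piece* with chart `x ↦ inr (x/2)` and with the surgery-ball chart of
the corresponding end of the tube (`SurgeryGlueData.halfCut b`, uniformly in the end `b`, the
neck being `τ ↦ ι (θ, 1/2 ± τ)`). The complexity `3 · #tubes + #balls` drops
(`complexity_halfCut_lt`).

## References

* R. S. Hamilton, *Four-manifolds with positive isotropic curvature*, Comm. Anal. Geom. 5 (1997)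
  1–92, §1.1 pp. 3–4. [Hamilton1997]
* B.-L. Chen, X.-P. Zhu, *Ricci flow with surgery on four-manifolds with positive isotropic
  curvature*, J. Differential Geom. 74 (2006), Thm. 1.1 (iii). [ChenZhu2006]
-/

open scoped Manifold ContDiff Topology
open Set Function Metric Module Filter OpenPartialHomeomorph Topology

noncomputable section

namespace Literature.Topology.FourManifolds

open CollarProfile TubeProfile

namespace SurgeryGlueData

variable {E : Type} [NormedAddCommGroup E] [InnerProductSpace ℝ E] {n : ℕ} [Fact (finrank ℝ E = n + 1)]
  {Q M' : Type} [TopologicalSpace Q] [ChartedSpace E Q] [TopologicalSpace M'] [ChartedSpace E M']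
  (G : SurgeryGlueData E n Q M') (i₀ : G.P.It)

/-! ### The two middle necks of a tube -/

/-- The sign of an end: `+1` for the upper end `true`, `-1` for the lower end `false`. [folklore] -/
def endSign (b : Bool) : ℝ := bif b then 1 else -1

/-- `endSign`: elementary bookkeeping (endSign true). [folklore] -/
@[simp] theorem endSign_true : endSign true = 1 := rfl

/-- `endSign`: elementary bookkeeping (endSign false). [folklore] -/
@[simp] theorem endSign_false : endSign false = -1 := rfl

/-- `1/2 + σ_b / 2` is the height of the end `b`. [folklore] -/
theorem half_add_endSign_half (b : Bool) : 1 / 2 + endSign b * (1 / 2) = endHeight b := by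
  cases b <;> norm_num [endSign]

/-- Heights `1/2 + σ_b s`, `0 < s < 1/2`, form the half at the end `b`. [folklore] -/
theorem half_add_endSign_mem_halfIoo (b : Bool) {s : ℝ} (hs : 0 < s) (hs' : s < 1 / 2) :
    1 / 2 + endSign b * s ∈ halfIoo b := by
  cases b <;> simp only [endSign_true, endSign_false, halfIoo_true, halfIoo_false, mem_Ioo] <;> constructor <;> linarith

/-- A height in the half at the end `b` is `1/2 + σ_b s` with `0 < s < 1/2`. [folklore] -/
theorem exists_of_mem_halfIoo (b : Bool) {t : ℝ} (ht : t ∈ halfIoo b) :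
    ∃ s, 0 < s ∧ s < 1 / 2 ∧ t = 1 / 2 + endSign b * s := by
  cases b <;> simp only [halfIoo_true, halfIoo_false, mem_Ioo, endSign_true, endSign_false] at ht ⊢
  · exact ⟨1 / 2 - t, by linarith, by linarith, by ring⟩
  · exact ⟨t - 1 / 2, by linarith, by linarith, by ring⟩

/-- Heights `1/2 + σ_b s` with `s ≥ 1/2` are off `(0, 1)`. [folklore] -/
theorem half_add_endSign_not_mem_Ioo (b : Bool) {s : ℝ} (hs : 1 / 2 ≤ s) : 1 / 2 + endSign b * s ∉ Ioo (0 : ℝ) 1 := by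
  cases b <;> simp only [endSign_true, endSign_false, mem_Ioo, not_and, not_lt] <;> intro <;> linarith

/-- Heights `1/2 + σ_b s` with `s > 0`. [folklore] -/
theorem half_add_endSign_ne_half (b : Bool) {s : ℝ} (hs : 0 < s) : 1 / 2 + endSign b * s ≠ 1 / 2 := by
  cases b <;> simp [endSign] <;> linarith

/-- **The middle neck towards the end `b`**: `ψ_b (θ, τ) = ι (θ, 1/2 + σ_b τ)`. [cite: Hamilton1997, §1.1 pp. 3–4] -/
def midNeck (b : Bool) (q : sphere (0 : E) 1 × ℝ) : Q := G.P.tube i₀ (q.1, 1 / 2 + endSign b * q.2)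

/-- `midNeck_apply`: elementary bookkeeping (midNeck apply). [folklore] -/
@[simp] theorem midNeck_apply (b : Bool) (θ : sphere (0 : E) 1) (τ : ℝ) :
    G.midNeck i₀ b (θ, τ) = G.P.tube i₀ (θ, 1 / 2 + endSign b * τ) := rfl

/-- The affine map `(θ, τ) ↦ (θ, 1/2 + σ_b τ)`, a diffeomorphism. [folklore] -/
def tubeAffine (b : Bool) : (sphere (0 : E) 1 × ℝ) ≃ₘ⟮(𝓡 n).prod 𝓘(ℝ, ℝ), (𝓡 n).prod 𝓘(ℝ, ℝ)⟯ (sphere (0 : E) 1 × ℝ) :=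
  (Diffeomorph.refl (𝓡 n) (sphere (0 : E) 1) ∞).prodCongr
    { toEquiv := ⟨fun t => 1 / 2 + endSign b * t, fun t => endSign b * (t - 1 / 2),
        fun t => by cases b <;> simp [endSign], fun t => by cases b <;> simp [endSign]⟩
      contMDiff_toFun := contMDiff_const.add (contMDiff_const.mul contMDiff_id)
      contMDiff_invFun := contMDiff_const.mul (contMDiff_id.sub contMDiff_const) }

/-- `midNeck_eq`: elementary bookkeeping (midNeck eq). [folklore] -/
theorem midNeck_eq (b : Bool) : G.midNeck i₀ b = G.P.tube i₀ ∘ tubeAffine (n := n) b := rfl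

/-- The middle necks are smooth embeddings with the (open) range of the tube. [folklore] -/
theorem isSmoothEmbedding_midNeck (b : Bool) : Manifold.IsSmoothEmbedding ((𝓡 n).prod 𝓘(ℝ, ℝ)) 𝓘(ℝ, E) ∞ (G.midNeck i₀ b) := by
  rw [midNeck_eq]; exact (G.P.isSmoothEmbedding_tube i₀).comp_diffeomorph _

/-- `range_midNeck`: elementary bookkeeping (range midNeck). [folklore] -/
theorem range_midNeck (b : Bool) : range (G.midNeck i₀ b) = range (G.P.tube i₀) := by
  rw [midNeck_eq, EquivLike.range_comp]

/-- `isOpen_range_midNeck`: elementary bookkeeping (isOpen range midNeck). [folklore] -/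
theorem isOpen_range_midNeck (b : Bool) : IsOpen (range (G.midNeck i₀ b)) := by
  rw [range_midNeck]; exact G.P.isOpen_range_tube i₀

/-- **The flipped upper middle neck is the lower middle neck.** [folklore] -/
theorem midNeck_true_neg (θ : sphere (0 : E) 1) (τ : ℝ) : G.midNeck i₀ true (θ, -τ) = G.midNeck i₀ false (θ, τ) := by
  simp [midNeck, endSign]

/-- In a simply connected manifold the upper middle neck has two sides, the second being a side
of the lower middle neck (`n ≠ 0`). [cite: Hirsch1976, Ch. 4 Thm. 4.6] -/
theorem exists_sides_midNeck [T2Space Q] [SimplyConnectedSpace Q] [IsManifold 𝓘(ℝ, E) ∞ Q] (hn : n ≠ 0) :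
    ∃ (D₁ : NeckCapData n (G.midNeck i₀ true)) (D₂ : NeckCapData n (fun q : sphere (0 : E) 1 × ℝ => G.midNeck i₀ true (q.1, -q.2))),
      Disjoint (D₁.side : Set Q) D₂.side ∧
      ∀ p : Q, p ∉ D₁.side → p ∉ D₂.side → ∃ θ : sphere (0 : E) 1, G.midNeck i₀ true (θ, 0) = p :=
  exists_neckCapData_of_simplyConnected hn (G.isSmoothEmbedding_midNeck i₀ true) (G.isOpen_range_midNeck i₀ true)

/-! ### A side of a middle neck -/

section HalfCut

variable (b : Bool) {ψ : sphere (0 : E) 1 × ℝ → Q} (hψ : ∀ (θ : sphere (0 : E) 1) (τ : ℝ), ψ (θ, τ) = G.P.tube i₀ (θ, 1 / 2 + endSign b * τ))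
  (D : NeckCapData n ψ)

include hψ

/-- A point of the tube at height `1/2 + σ_b s` is in the side iff `s > 0`. [folklore] -/
theorem tube_mem_side_iff (θ : sphere (0 : E) 1) (s : ℝ) : G.P.tube i₀ (θ, 1 / 2 + endSign b * s) ∈ (D.side : Set Q) ↔ 0 < s := by
  rw [← hψ]; exact D.mem_side_iff θ s

/-- The middle sphere `ι (𝕊ⁿ × {1/2})` is the central slice of the neck. [folklore] -/
theorem midSlice_eq : ψ '' (univ ×ˢ {0}) = G.P.tube i₀ '' (univ ×ˢ {1 / 2}) := by
  apply Subset.antisymm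
  · rintro _ ⟨⟨θ, t⟩, ⟨-, ht⟩, rfl⟩
    rw [mem_singleton_iff] at ht; subst ht
    exact ⟨(θ, 1 / 2), ⟨mem_univ _, rfl⟩, by rw [hψ]; simp⟩
  · rintro _ ⟨⟨θ, t⟩, ⟨-, ht⟩, rfl⟩
    rw [mem_singleton_iff] at ht; subst ht
    exact ⟨(θ, 0), ⟨mem_univ _, rfl⟩, by rw [hψ]; simp⟩

/-- The middle sphere lies in the tube piece, hence in its footprint. [folklore] -/
theorem midSlice_subset_pieceT : ψ '' (univ ×ˢ {0}) ⊆ G.P.pieceT i₀ := by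
  rw [G.midSlice_eq i₀ b hψ]
  rintro _ ⟨⟨θ, t⟩, ⟨-, ht⟩, rfl⟩
  rw [mem_singleton_iff] at ht; subst ht
  exact ⟨(θ, 1 / 2), ⟨mem_univ _, by norm_num, by norm_num⟩, rfl⟩

/-- **Every other footprint lies in the side or misses it**: it is connected and misses the
middle sphere, and the side is clopen in the complement of the middle sphere. [folklore] -/
theorem foot_subset_or_disjoint (hn : n ≠ 0) {a : G.P.Idx} (ha : a ≠ Sum.inl i₀) :
    G.P.foot a ⊆ (D.side : Set Q) ∨ Disjoint (G.P.foot a) (D.side : Set Q) := by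
  set S : Set Q := ψ '' (univ ×ˢ {0}) with hS
  have hfS : Disjoint (G.P.foot a) S := by
    refine Set.disjoint_left.2 fun p hp hq => ?_
    exact Set.disjoint_left.1 (G.disjoint_foot a (Sum.inl i₀) ha) hp (G.P.pieceT_subset_foot i₀ (G.midSlice_subset_pieceT i₀ b hψ hq))
  have hV : IsOpen ((D.side : Set Q) ∪ S)ᶜ := D.isClosed_side_union.isOpen_compl
  have hcover : G.P.foot a ⊆ (D.side : Set Q) ∪ ((D.side : Set Q) ∪ S)ᶜ := fun p hp => by
    by_cases h : p ∈ (D.side : Set Q)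
    · exact Or.inl h
    · exact Or.inr fun h' => h'.elim h (Set.disjoint_left.1 hfS hp)
  have hUV : Disjoint (D.side : Set Q) ((D.side : Set Q) ∪ S)ᶜ := Set.disjoint_left.2 fun p hp hq => hq (Or.inl hp)
  rcases (G.isConnected_foot hn a).isPreconnected.subset_or_subset D.side.2 hV hUV hcover with h | h
  · exact Or.inl h
  · exact Or.inr (Set.disjoint_left.2 fun p hp hq => h hp (Or.inl hq))

/-- A connected subset of the common part meeting the side lies in the side. [folklore] -/
theorem subset_side_of_isConnected {C : Set Q} (hC : IsConnected C) (hCN : C ⊆ G.P.N) (hmeet : (C ∩ (D.side : Set Q)).Nonempty) :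
    C ⊆ (D.side : Set Q) := by
  set S : Set Q := ψ '' (univ ×ˢ {0}) with hS
  have hCS : Disjoint C S := Set.disjoint_left.2 fun p hp hq =>
    ((GluePieces.mem_N_iff _).1 (hCN hp)) (Sum.inl i₀) (G.midSlice_subset_pieceT i₀ b hψ hq)
  have hV : IsOpen ((D.side : Set Q) ∪ S)ᶜ := D.isClosed_side_union.isOpen_compl
  have hcover : C ⊆ (D.side : Set Q) ∪ ((D.side : Set Q) ∪ S)ᶜ := fun p hp => by
    by_cases h : p ∈ (D.side : Set Q)
    · exact Or.inl h
    · exact Or.inr fun h' => h'.elim h (Set.disjoint_left.1 hCS hp)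
  have hUV : Disjoint (D.side : Set Q) ((D.side : Set Q) ∪ S)ᶜ := Set.disjoint_left.2 fun p hp hq => hq (Or.inl hp)
  rcases hC.isPreconnected.subset_or_subset D.side.2 hV hUV hcover with h | h
  · exact h
  · obtain ⟨p, hpC, hps⟩ := hmeet
    exact absurd (Or.inl hps) (h hpC)

/-- The end sphere at the end `b` lies in the side. [folklore] -/
theorem tubeSphere_subset_side : G.P.tubeSphere i₀ b ⊆ (D.side : Set Q) := by
  rintro _ ⟨⟨θ, t⟩, ⟨-, ht⟩, rfl⟩
  rw [mem_singleton_iff] at ht; subst ht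
  rw [← half_add_endSign_half, G.tube_mem_side_iff i₀ b hψ D]
  norm_num

/-- The half of the tube at the end `b` lies in the side. [folklore] -/
theorem tube_half_subset_side : G.P.tube i₀ '' (univ ×ˢ halfIoo b) ⊆ (D.side : Set Q) := by
  rintro _ ⟨⟨θ, t⟩, ⟨-, ht⟩, rfl⟩
  obtain ⟨s, hs, -, rfl⟩ := exists_of_mem_halfIoo b ht
  exact (G.tube_mem_side_iff i₀ b hψ D θ s).2 hs

/-- **The collar shell of the end `b`, pulled back, lies in the side** (`n ≠ 0`): its inner part
lies in the adjacent half of the tube, its outer part is connected, lies in the common part and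
contains the end sphere. [folklore] -/
theorem symm_image_tubeM_shell_subset_side (hn : n ≠ 0) :
    G.P.e.symm '' (G.P.tubeM i₀ b '' shell (G.P.tubeε i₀ b) (G.P.tubeδ i₀ b)) ⊆ (D.side : Set Q) := by
  have houter : G.P.e.symm '' (G.P.tubeM i₀ b '' outerAnnulus (G.P.tubeε i₀ b)) ⊆ (D.side : Set Q) := by
    obtain ⟨hconn, hsph⟩ := G.isConnected_symm_image_tubeM_outerAnnulus hn i₀ b
    refine G.subset_side_of_isConnected i₀ b hψ D hconn (G.tubeM_outer i₀ b) ?_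
    obtain ⟨p, hp⟩ := G.tubeSphere_nonempty i₀ b
    exact ⟨p, hsph hp, G.tubeSphere_subset_side i₀ b hψ D hp⟩
  rintro _ ⟨_, ⟨y, hy, rfl⟩, rfl⟩
  rcases lt_or_ge ‖y‖ 1 with h1 | h1
  · have hyt : G.P.tubeM i₀ b y ∈ G.P.e.target := G.tubeM_shell i₀ b ⟨y, hy, rfl⟩
    exact G.tube_half_subset_side i₀ b hψ D (G.tubeM_inner i₀ b ⟨_, ⟨⟨y, mem_ball_zero_iff.2 h1, rfl⟩, hyt⟩, rfl⟩)
  · exact houter ⟨_, ⟨y, ⟨h1, hy.2⟩, rfl⟩, rfl⟩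

omit hψ in
/-- A nonzero cap point is the tube point at height `1/2 + σ_b ‖x‖`. [folklore] -/
theorem inr_eq_inl_tube {x : E} (hx : x ≠ 0) (hψ : ∀ (θ : sphere (0 : E) 1) (τ : ℝ), ψ (θ, τ) = G.P.tube i₀ (θ, 1 / 2 + endSign b * τ)) :
    D.glueData.inr x = D.glueData.inl ⟨G.P.tube i₀ (unitDir (unitSpherePoint n) x, 1 / 2 + endSign b * ‖x‖),
      (G.tube_mem_side_iff i₀ b hψ D _ _).2 (norm_pos_iff.2 hx)⟩ := by
  have h := D.inl_eq_inr (unitDir (unitSpherePoint n) x) (norm_pos_iff.2 hx)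
  rw [norm_smul_coe_unitDir _ hx] at h
  rw [← h]
  congr 1
  apply Subtype.ext
  exact hψ _ _

/-- The range of the cap disc: the centre, and tube points at heights `1/2 + σ_b t`, `t > 0`. [folklore] -/
theorem mem_range_inr_cases {p : D.Capped} (hp : p ∈ range D.glueData.inr) :
    p = D.glueData.inr 0 ∨ ∃ (θ : sphere (0 : E) 1) (t : ℝ) (ht : 0 < t),
      p = D.glueData.inl ⟨G.P.tube i₀ (θ, 1 / 2 + endSign b * t), (G.tube_mem_side_iff i₀ b hψ D θ t).2 ht⟩ := by
  obtain ⟨x, rfl⟩ := hp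
  rcases eq_or_ne x 0 with rfl | hx
  · exact Or.inl rfl
  · exact Or.inr ⟨_, _, norm_pos_iff.2 hx, G.inr_eq_inl_tube i₀ b D hx hψ⟩

/-- The range of the cap disc off the centre lies in `inlSet` of the range of the tube. [folklore] -/
theorem range_inr_subset_tube : range D.glueData.inr ⊆ insert (D.glueData.inr 0) (D.inlSet (G.P.foot (Sum.inl i₀))) := by
  intro p hp
  rcases G.mem_range_inr_cases i₀ b hψ D hp with rfl | ⟨θ, t, ht, rfl⟩
  · exact mem_insert _ _
  · exact Or.inr (D.inl_mem_inlSet_iff.2 (G.P.range_tube_subset_foot i₀ ⟨_, rfl⟩))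

/-! #### The new ball: the capped half-tube -/

variable [IsManifold 𝓘(ℝ, E) ∞ Q]

omit hψ [IsManifold 𝓘(ℝ, E) ∞ Q] in
/-- **The chart of the capped half-tube**: `x ↦ inr (x/2)`. [folklore] -/
def _root_.Literature.Topology.FourManifolds.NeckCapData.halfBall (x : E) : D.Capped := D.glueData.inr ((1 / 2 : ℝ) • x)

omit hψ in
/-- The halving diffeomorphism of `E`. [folklore] -/
def _root_.Literature.Topology.FourManifolds.halving : E ≃ₘ⟮𝓘(ℝ, E), 𝓘(ℝ, E)⟯ E where
  toEquiv := ⟨fun x => (1 / 2 : ℝ) • x, fun x => (2 : ℝ) • x, fun x => by simp [smul_smul], fun x => by simp [smul_smul]⟩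
  contMDiff_toFun := contMDiff_iff_contDiff.2 (contDiff_const_smul _)
  contMDiff_invFun := contMDiff_iff_contDiff.2 (contDiff_const_smul _)

omit hψ [IsManifold 𝓘(ℝ, E) ∞ Q] in
/-- `halfBall_eq`: elementary bookkeeping (halfBall eq). [folklore] -/
theorem _root_.Literature.Topology.FourManifolds.NeckCapData.halfBall_eq : D.halfBall = D.glueData.inr ∘ (halving (E := E)) := rfl

omit hψ in
/-- The chart of the capped half-tube is a smooth embedding with open range `range inr`. [folklore] -/
theorem _root_.Literature.Topology.FourManifolds.NeckCapData.isSmoothEmbedding_halfBall : Manifold.IsSmoothEmbedding 𝓘(ℝ, E) 𝓘(ℝ, E) ∞ (D.halfBall) := by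
  rw [NeckCapData.halfBall_eq]; exact D.glueData.isSmoothEmbedding_inr.comp_diffeomorph _

omit hψ [IsManifold 𝓘(ℝ, E) ∞ Q] in
/-- `range_halfBall`: elementary bookkeeping (range halfBall). [folklore] -/
theorem _root_.Literature.Topology.FourManifolds.NeckCapData.range_halfBall : range (D.halfBall) = range D.glueData.inr := by
  rw [NeckCapData.halfBall_eq, EquivLike.range_comp]

omit hψ [IsManifold 𝓘(ℝ, E) ∞ Q] in
/-- `isOpen_range_halfBall`: elementary bookkeeping (isOpen range halfBall). [folklore] -/
theorem _root_.Literature.Topology.FourManifolds.NeckCapData.isOpen_range_halfBall : IsOpen (range (D.halfBall)) := by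
  rw [NeckCapData.range_halfBall]; exact D.glueData.isOpen_range_inr

omit hψ [IsManifold 𝓘(ℝ, E) ∞ Q] in
/-- The new ball piece is the half-disc of the cap. [folklore] -/
theorem _root_.Literature.Topology.FourManifolds.NeckCapData.image_halfBall_ball : D.halfBall '' Metric.ball 0 1 = D.glueData.inr '' Metric.ball 0 (1 / 2) := by
  apply Subset.antisymm
  · rintro _ ⟨x, hx, rfl⟩
    refine ⟨(1 / 2 : ℝ) • x, ?_, rfl⟩
    rw [mem_ball_zero_iff] at hx ⊢; rw [norm_smul]; norm_num; linarith
  · rintro _ ⟨y, hy, rfl⟩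
    refine ⟨(2 : ℝ) • y, ?_, by simp [NeckCapData.halfBall, smul_smul]⟩
    rw [mem_ball_zero_iff] at hy ⊢; rw [norm_smul]; norm_num; linarith

omit [IsManifold 𝓘(ℝ, E) ∞ Q] in
/-- A tube point of the adjacent half is in the new ball piece. [folklore] -/
theorem tube_half_mem_image_halfBall {θ : sphere (0 : E) 1} {s : ℝ} (hs : 0 < s) (hs' : s < 1 / 2)
    (hmem : G.P.tube i₀ (θ, 1 / 2 + endSign b * s) ∈ (D.side : Set Q)) :
    D.glueData.inl ⟨G.P.tube i₀ (θ, 1 / 2 + endSign b * s), hmem⟩ ∈ D.halfBall '' Metric.ball 0 1 := by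
  rw [NeckCapData.image_halfBall_ball]
  refine ⟨s • (θ : E), by rw [mem_ball_zero_iff, BallCollarData.norm_smul_sphere θ hs]; exact hs', ?_⟩
  rw [← D.inl_eq_inr θ hs]
  congr 1; apply Subtype.ext; exact hψ _ _

omit [IsManifold 𝓘(ℝ, E) ∞ Q] in
/-- The unit sphere of the new ball is `inlSet` of the end sphere. [folklore] -/
theorem image_halfBall_sphere : D.halfBall '' sphere 0 1 = D.inlSet (G.P.tubeSphere i₀ b) := by
  apply Subset.antisymm
  · rintro _ ⟨x, hx, rfl⟩
    replace hx : ‖x‖ = 1 := mem_sphere_zero_iff_norm.1 hx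
    have hx0 : x ≠ 0 := by rintro rfl; rw [norm_zero] at hx; norm_num at hx
    have h2 : ((1 / 2 : ℝ) • x) ≠ 0 := smul_ne_zero (by norm_num) hx0
    change D.glueData.inr ((1 / 2 : ℝ) • x) ∈ _
    rw [G.inr_eq_inl_tube i₀ b D h2 hψ, NeckCapData.inl_mem_inlSet_iff]
    refine ⟨(unitDir (unitSpherePoint n) ((1 / 2 : ℝ) • x), endHeight b), ⟨mem_univ _, rfl⟩, ?_⟩
    change G.P.tube i₀ (unitDir (unitSpherePoint n) ((1 / 2 : ℝ) • x), endHeight b) =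
      G.P.tube i₀ (unitDir (unitSpherePoint n) ((1 / 2 : ℝ) • x), 1 / 2 + endSign b * ‖(1 / 2 : ℝ) • x‖)
    rw [norm_smul, hx, Real.norm_of_nonneg (by norm_num : (0 : ℝ) ≤ 1 / 2), mul_one, half_add_endSign_half]
  · rintro _ ⟨a, ⟨⟨θ, t⟩, ⟨-, ht⟩, hta⟩, rfl⟩
    rw [mem_singleton_iff] at ht; subst ht
    refine ⟨(θ : E), by simp, ?_⟩
    change D.glueData.inr ((1 / 2 : ℝ) • (θ : E)) = _
    have key := D.inl_eq_inr θ (by norm_num : (0 : ℝ) < 1 / 2)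
    refine key.symm.trans ?_
    congr 1; apply Subtype.ext
    change ψ (θ, 1 / 2) = (a : Q)
    rw [hψ, half_add_endSign_half]; exact hta

/-! #### The pieces of the cut datum -/

omit hψ in
/-- `subIt`: the tubes other than `i₀` inside the side. [folklore] -/
abbrev subIt : Type := {i : G.P.It // i ≠ i₀ ∧ G.P.foot (Sum.inl i) ⊆ (D.side : Set Q)}

omit hψ in
/-- `subIb`: the balls inside the side. [folklore] -/
abbrev subIb : Type := {j : G.P.Ib // G.P.foot (Sum.inr (Sum.inl j)) ⊆ (D.side : Set Q)}

omit hψ in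
/-- `subIm`: the matched balls inside the side. [folklore] -/
abbrev subIm : Type := {k : G.P.Im // G.P.foot (Sum.inr (Sum.inr k)) ⊆ (D.side : Set Q)}

/-- **The pieces of the capped side of a middle neck.** [folklore] -/
def halfCutPieces : GluePieces E n D.Capped M' where
  e := D.transport G.P.e
  contMDiffOn_e := D.contMDiffOn_transport G.P.contMDiffOn_e
  contMDiffOn_e_symm := D.contMDiffOn_transport_symm G.P.contMDiffOn_e_symm
  It := G.subIt i₀ D
  Ib := G.subIb D ⊕ PUnit
  Im := G.subIm D
  fintypeIt := by classical exact Subtype.fintype _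
  fintypeIb := by classical exact inferInstance
  fintypeIm := by classical exact Subtype.fintype _
  tube i := D.liftMap (G.P.tube i.1) fun q => i.2.2 (G.P.range_tube_subset_foot i.1 ⟨q, rfl⟩)
  tubeM i := G.P.tubeM i.1
  tubeε i := G.P.tubeε i.1
  tubeδ i := G.P.tubeδ i.1
  ball := fun j => match j with
    | Sum.inl j => D.liftMap (G.P.ball j.1) fun x => j.2 (G.P.range_ball_subset_foot j.1 ⟨x, rfl⟩)
    | Sum.inr _ => D.halfBall
  ballM := fun j => match j with
    | Sum.inl j => G.P.ballM j.1
    | Sum.inr _ => G.P.tubeM i₀ b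
  ballε := fun j => match j with
    | Sum.inl j => G.P.ballε j.1
    | Sum.inr _ => G.P.tubeε i₀ b
  ballδ := fun j => match j with
    | Sum.inl j => G.P.ballδ j.1
    | Sum.inr _ => G.P.tubeδ i₀ b
  mball k := D.liftMap (G.P.mball k.1) fun x => k.2 (G.P.range_mball_subset_foot k.1 ⟨x, rfl⟩)
  mballM k := G.P.mballM k.1
  mprof k := G.P.mprof k.1
  isSmoothEmbedding_tube i := D.isSmoothEmbedding_liftMap (G.P.isSmoothEmbedding_tube i.1) _
  isOpen_range_tube i := D.isOpen_range_liftMap (G.P.isOpen_range_tube i.1) _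
  isSmoothEmbedding_tubeM i := G.P.isSmoothEmbedding_tubeM i.1
  isOpen_range_tubeM i := G.P.isOpen_range_tubeM i.1
  isSmoothEmbedding_ball j := by
    rcases j with j | u
    · exact D.isSmoothEmbedding_liftMap (G.P.isSmoothEmbedding_ball j.1) _
    · exact D.isSmoothEmbedding_halfBall
  isOpen_range_ball j := by
    rcases j with j | u
    · exact D.isOpen_range_liftMap (G.P.isOpen_range_ball j.1) _
    · exact D.isOpen_range_halfBall
  isSmoothEmbedding_ballM j := by
    rcases j with j | u
    · exact G.P.isSmoothEmbedding_ballM j.1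
    · exact G.P.isSmoothEmbedding_tubeM i₀ b
  isOpen_range_ballM j := by
    rcases j with j | u
    · exact G.P.isOpen_range_ballM j.1
    · exact G.P.isOpen_range_tubeM i₀ b
  isSmoothEmbedding_mball k := D.isSmoothEmbedding_liftMap (G.P.isSmoothEmbedding_mball k.1) _
  isOpen_range_mball k := D.isOpen_range_liftMap (G.P.isOpen_range_mball k.1) _
  isSmoothEmbedding_mballM k := G.P.isSmoothEmbedding_mballM k.1
  isOpen_range_mballM k := G.P.isOpen_range_mballM k.1
  tubeε_pos i b' := G.P.tubeε_pos i.1 b'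
  tubeδ_pos i b' := G.P.tubeδ_pos i.1 b'
  tubeδ_lt_one i b' := G.P.tubeδ_lt_one i.1 b'
  ballε_pos j := by
    rcases j with j | u
    · exact G.P.ballε_pos j.1
    · exact G.P.tubeε_pos i₀ b
  ballδ_pos j := by
    rcases j with j | u
    · exact G.P.ballδ_pos j.1
    · exact G.P.tubeδ_pos i₀ b
  ballδ_lt_one j := by
    rcases j with j | u
    · exact G.P.ballδ_lt_one j.1
    · exact G.P.tubeδ_lt_one i₀ b
  contDiff_mprof k := G.P.contDiff_mprof k.1
  strictMono_mprof k := G.P.strictMono_mprof k.1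
  deriv_mprof_pos k := G.P.deriv_mprof_pos k.1
  mprof_pos k := G.P.mprof_pos k.1

/-- Local notation for the cut pieces. -/
local notation "Hc" => SurgeryGlueData.halfCutPieces G i₀ b D

omit hψ in
/-- `halfCutPieces_e`: elementary bookkeeping (halfCutPieces e). [folklore] -/
@[simp] theorem halfCutPieces_e : (Hc).e = D.transport G.P.e := rfl

omit hψ in
/-- The old index of a new index (the new ball goes to the tube `i₀`). [folklore] -/
def oldIdxH : (Hc).Idx → G.P.Idx
  | Sum.inl i => Sum.inl i.1
  | Sum.inr (Sum.inl (Sum.inl j)) => Sum.inr (Sum.inl j.1)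
  | Sum.inr (Sum.inl (Sum.inr _)) => Sum.inl i₀
  | Sum.inr (Sum.inr k) => Sum.inr (Sum.inr k.1)

omit hψ in
/-- `oldIdxH_injective`: elementary bookkeeping (oldIdxH injective). [folklore] -/
theorem oldIdxH_injective : Injective (G.oldIdxH i₀ b D) := by
  rintro (i | (j | u) | k) (i' | (j' | u') | k') h
  all_goals simp only [oldIdxH, Sum.inl.injEq, Sum.inr.injEq, reduceCtorEq] at h
  all_goals first
    | rfl
    | exact absurd h i.2.1
    | exact absurd h.symm i'.2.1
    | rw [Subtype.ext h]

omit hψ in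
/-- An index is old iff it is not the new ball. [folklore] -/
def IsOldIdxH : (Hc).Idx → Prop
  | Sum.inr (Sum.inl (Sum.inr _)) => False
  | _ => True

omit hψ in
/-- The footprint of an old index lies in the side. [folklore] -/
theorem foot_oldIdxH_subset_side {a : (Hc).Idx} (ha : G.IsOldIdxH i₀ b D a) : G.P.foot (G.oldIdxH i₀ b D a) ⊆ (D.side : Set Q) := by
  rcases a with i | (j | u) | k
  · exact i.2.2
  · exact j.2
  · exact absurd ha id
  · exact k.2

omit hψ in
/-- `oldIdxH_ne`: elementary bookkeeping (oldIdxH ne). [folklore] -/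
theorem oldIdxH_ne {a : (Hc).Idx} (ha : G.IsOldIdxH i₀ b D a) : G.oldIdxH i₀ b D a ≠ Sum.inl i₀ := by
  rcases a with i | (j | u) | k
  · exact fun h => i.2.1 (Sum.inl_injective h)
  · simp [oldIdxH]
  · exact absurd ha id
  · simp [oldIdxH]

omit hψ in
/-- Collar shells of old pieces lie in the target of the transported `e`. [folklore] -/
theorem tubeM_shell_subset_targetH (i : G.subIt i₀ D) (b' : Bool) :
    G.P.tubeM i.1 b' '' shell (G.P.tubeε i.1 b') (G.P.tubeδ i.1 b') ⊆ (Hc).e.target :=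
  D.subset_transport_target (G.tubeM_shell i.1 b') (fun _ hp => i.2.2 (Or.inr (mem_iUnion.2 ⟨b', hp⟩)))

omit hψ in
/-- `ballM_shell_subset_targetH`: elementary bookkeeping (ballM shell subset targetH). [folklore] -/
theorem ballM_shell_subset_targetH (j : G.subIb D) :
    G.P.ballM j.1 '' shell (G.P.ballε j.1) (G.P.ballδ j.1) ⊆ (Hc).e.target :=
  D.subset_transport_target (G.ballM_shell j.1) (fun _ hp => j.2 (Or.inr hp))

/-- The collar shell of the kept end lies in the target of the transported `e`. [folklore] -/
theorem tubeM_end_shell_subset_targetH (hn : n ≠ 0) :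
    G.P.tubeM i₀ b '' shell (G.P.tubeε i₀ b) (G.P.tubeδ i₀ b) ⊆ (Hc).e.target :=
  D.subset_transport_target (G.tubeM_shell i₀ b) (G.symm_image_tubeM_shell_subset_side i₀ b hψ D hn)

omit hψ in
/-- Footprints of old indices are `inlSet` of the old footprints. [folklore] -/
theorem foot_oldH {a : (Hc).Idx} (ha : G.IsOldIdxH i₀ b D a) : (Hc).foot a = D.inlSet (G.P.foot (G.oldIdxH i₀ b D a)) := by
  rcases a with i | (j | u) | k
  · change range (D.liftMap (G.P.tube i.1) _) ∪ ⋃ b', (Hc).e.symm '' (G.P.tubeM i.1 b' '' shell (G.P.tubeε i.1 b') (G.P.tubeδ i.1 b')) =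
      D.inlSet (range (G.P.tube i.1) ∪ ⋃ b', G.P.e.symm '' (G.P.tubeM i.1 b' '' shell (G.P.tubeε i.1 b') (G.P.tubeδ i.1 b')))
    rw [NeckCapData.inlSet_union, NeckCapData.inlSet_iUnion, NeckCapData.range_liftMap]
    congr 1
    refine iUnion_congr fun b' => ?_
    rw [halfCutPieces_e, D.transport_symm_image (G.tubeM_shell_subset_targetH i₀ b D i b')]
  · change range (D.liftMap (G.P.ball j.1) _) ∪ (Hc).e.symm '' (G.P.ballM j.1 '' shell (G.P.ballε j.1) (G.P.ballδ j.1)) =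
      D.inlSet (range (G.P.ball j.1) ∪ G.P.e.symm '' (G.P.ballM j.1 '' shell (G.P.ballε j.1) (G.P.ballδ j.1)))
    rw [NeckCapData.inlSet_union, NeckCapData.range_liftMap, halfCutPieces_e, D.transport_symm_image (G.ballM_shell_subset_targetH i₀ b D j)]
    rfl
  · exact absurd ha id
  · change range (D.liftMap (G.P.mball k.1) _) = D.inlSet (range (G.P.mball k.1))
    rw [NeckCapData.range_liftMap]; rfl

/-- The footprint of the new ball lies in `{inr 0} ∪ inlSet (foot i₀)`. [folklore] -/
theorem foot_newH_subset (hn : n ≠ 0) (u : PUnit) :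
    (Hc).foot (Sum.inr (Sum.inl (Sum.inr u))) ⊆ insert (D.glueData.inr 0) (D.inlSet (G.P.foot (Sum.inl i₀))) := by
  change range (D.halfBall) ∪ (Hc).e.symm '' (G.P.tubeM i₀ b '' shell (G.P.tubeε i₀ b) (G.P.tubeδ i₀ b)) ⊆ _
  rw [NeckCapData.range_halfBall, halfCutPieces_e, D.transport_symm_image (G.tubeM_end_shell_subset_targetH i₀ b hψ D hn)]
  refine union_subset (G.range_inr_subset_tube i₀ b hψ D) fun p hp => Or.inr (D.inlSet_mono (t := G.P.foot (Sum.inl i₀)) (fun q hq => Or.inr (mem_iUnion.2 ⟨b, hq⟩)) hp)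

/-- **Footprints of the cut datum are disjoint.** [folklore] -/
theorem disjoint_foot_halfCut (hn : n ≠ 0) (a a' : (Hc).Idx) (h : a ≠ a') : Disjoint ((Hc).foot a) ((Hc).foot a') := by
  have hold : ∀ {a : (Hc).Idx} (ha : G.IsOldIdxH i₀ b D a) (u : PUnit), Disjoint ((Hc).foot a) ((Hc).foot (Sum.inr (Sum.inl (Sum.inr u)))) := by
    intro a ha u
    rw [G.foot_oldH i₀ b D ha, Set.disjoint_left]
    intro p hp hq
    rcases G.foot_newH_subset i₀ b hψ D hn u hq with rfl | hq
    · exact D.inr_zero_not_mem_inlSet _ hp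
    · exact Set.disjoint_left.1 (D.disjoint_inlSet (G.disjoint_foot _ _ (G.oldIdxH_ne i₀ b D ha))) hp hq
  by_cases ha : G.IsOldIdxH i₀ b D a <;> by_cases ha' : G.IsOldIdxH i₀ b D a'
  · rw [G.foot_oldH i₀ b D ha, G.foot_oldH i₀ b D ha']
    exact D.disjoint_inlSet (G.disjoint_foot _ _ fun heq => h (G.oldIdxH_injective i₀ b D heq))
  · rcases a' with i | (j | u) | k
    · exact absurd trivial ha'
    · exact absurd trivial ha'
    · exact hold ha u
    · exact absurd trivial ha'
  · rcases a with i | (j | u) | k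
    · exact absurd trivial ha
    · exact absurd trivial ha
    · exact (hold ha' u).symm
    · exact absurd trivial ha
  · rcases a with i | (j | u) | k <;> rcases a' with i' | (j' | u') | k'
    all_goals first | exact absurd trivial ha | exact absurd trivial ha' | exact absurd rfl h

omit hψ in
/-- The old surgery-ball index of a new one (the new ball goes to the end `b` of `i₀`). [folklore] -/
def oldIdxMH : (Hc).IdxM → G.P.IdxM
  | Sum.inl ⟨i, b'⟩ => Sum.inl ⟨i.1, b'⟩
  | Sum.inr (Sum.inl (Sum.inl j)) => Sum.inr (Sum.inl j.1)
  | Sum.inr (Sum.inl (Sum.inr _)) => Sum.inl ⟨i₀, b⟩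
  | Sum.inr (Sum.inr k) => Sum.inr (Sum.inr k.1)

omit hψ in
/-- `oldIdxMH_injective`: elementary bookkeeping (oldIdxMH injective). [folklore] -/
theorem oldIdxMH_injective : Injective (G.oldIdxMH i₀ b D) := by
  rintro (⟨i, c⟩ | (j | u) | k) (⟨i', c'⟩ | (j' | u') | k') h
  all_goals simp only [oldIdxMH, Sum.inl.injEq, Sum.inr.injEq, reduceCtorEq, Prod.mk.injEq] at h
  all_goals first
    | rfl
    | exact absurd h.1 i.2.1
    | exact absurd h.1.symm i'.2.1
    | rw [Subtype.ext h.1, h.2]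
    | rw [Subtype.ext h]

omit hψ in
/-- `footM'_halfCut_eq`: elementary bookkeeping (footM' halfCut eq). [folklore] -/
theorem footM'_halfCut_eq (c : (Hc).IdxM) : (Hc).footM' c = G.P.footM' (G.oldIdxMH i₀ b D c) := by
  rcases c with ⟨i, c⟩ | (j | u) | k <;> rfl

omit hψ in
/-- **Footprints in `M'` of the cut datum are disjoint.** [folklore] -/
theorem disjoint_footM'_halfCut (c c' : (Hc).IdxM) (h : c ≠ c') : Disjoint ((Hc).footM' c) ((Hc).footM' c') := by
  rw [footM'_halfCut_eq, footM'_halfCut_eq]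
  exact G.disjoint_footM' _ _ fun heq => h (G.oldIdxMH_injective i₀ b D heq)

/-! #### The common part of the cut datum -/

omit hψ in
/-- Pieces at old indices are `inlSet` of the old pieces. [folklore] -/
theorem piece_oldH {a : (Hc).Idx} (ha : G.IsOldIdxH i₀ b D a) : (Hc).piece a = D.inlSet (G.P.piece (G.oldIdxH i₀ b D a)) := by
  rcases a with i | (j | u) | k
  · exact D.image_liftMap _ _ _
  · exact D.image_liftMap _ _ _
  · exact absurd ha id
  · exact D.image_liftMap _ _ _

omit hψ in
/-- The new piece is the half-disc of the cap. [folklore] -/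
theorem piece_newH (u : PUnit) : (Hc).piece (Sum.inr (Sum.inl (Sum.inr u))) = D.glueData.inr '' Metric.ball 0 (1 / 2) :=
  D.image_halfBall_ball

omit hψ in
/-- The new index of an old index whose footprint lies in the side. [folklore] -/
def newIdxH : (c : G.P.Idx) → c ≠ Sum.inl i₀ → G.P.foot c ⊆ (D.side : Set Q) → (Hc).Idx
  | Sum.inl i, h, hs => Sum.inl ⟨i, fun hi => h (by rw [hi]), hs⟩
  | Sum.inr (Sum.inl j), _, hs => Sum.inr (Sum.inl (Sum.inl ⟨j, hs⟩))
  | Sum.inr (Sum.inr k), _, hs => Sum.inr (Sum.inr ⟨k, hs⟩)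

omit hψ in
/-- `isOldIdxH_newIdxH`: elementary bookkeeping (isOldIdxH newIdxH). [folklore] -/
theorem isOldIdxH_newIdxH (c : G.P.Idx) (h : c ≠ Sum.inl i₀) (hs : G.P.foot c ⊆ (D.side : Set Q)) :
    G.IsOldIdxH i₀ b D (G.newIdxH i₀ b D c h hs) := by
  rcases c with i | j | k <;> exact trivial

omit hψ in
/-- `oldIdxH_newIdxH`: elementary bookkeeping (oldIdxH newIdxH). [folklore] -/
theorem oldIdxH_newIdxH (c : G.P.Idx) (h : c ≠ Sum.inl i₀) (hs : G.P.foot c ⊆ (D.side : Set Q)) :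
    G.oldIdxH i₀ b D (G.newIdxH i₀ b D c h hs) = c := by
  rcases c with i | j | k <;> rfl

omit [IsManifold 𝓘(ℝ, E) ∞ Q] in
/-- A point of the tube piece in the side is in the adjacent half. [folklore] -/
theorem exists_of_mem_pieceT_of_mem_side {p : Q} (hp : p ∈ G.P.pieceT i₀) (hps : p ∈ (D.side : Set Q)) :
    ∃ (θ : sphere (0 : E) 1) (s : ℝ), 0 < s ∧ s < 1 / 2 ∧ p = G.P.tube i₀ (θ, 1 / 2 + endSign b * s) := by
  obtain ⟨⟨θ, t⟩, ⟨-, ht⟩, rfl⟩ := hp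
  have hrepr : t = 1 / 2 + endSign b * (endSign b * (t - 1 / 2)) := by cases b <;> simp only [endSign_true, endSign_false] <;> ring
  rw [hrepr] at hps
  have hs := (G.tube_mem_side_iff i₀ b hψ D θ _).1 hps
  refine ⟨θ, endSign b * (t - 1 / 2), hs, ?_, by rw [← hrepr]⟩
  cases b <;> simp only [endSign_true, endSign_false] at hs ⊢ <;> nlinarith [ht.1, ht.2]

/-- **A point `inl a` of the new common part projects to the old common part.** [folklore] -/
theorem mem_N_of_inl_mem_NH (hn : n ≠ 0) {a : D.side} (h : D.glueData.inl a ∈ (Hc).N) : (a : Q) ∈ G.P.N := by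
  rw [GluePieces.mem_N_iff] at h ⊢
  intro c hc
  by_cases hci : c = Sum.inl i₀
  · subst hci
    obtain ⟨θ, s, hs, hs', hp⟩ := G.exists_of_mem_pieceT_of_mem_side i₀ b hψ D hc a.2
    apply h (Sum.inr (Sum.inl (Sum.inr PUnit.unit)))
    change D.glueData.inl a ∈ D.halfBall '' Metric.ball 0 1
    have hmem : G.P.tube i₀ (θ, 1 / 2 + endSign b * s) ∈ (D.side : Set Q) := by rw [← hp]; exact a.2
    have key := G.tube_half_mem_image_halfBall i₀ b hψ D hs hs' hmem
    rwa [show (⟨G.P.tube i₀ (θ, 1 / 2 + endSign b * s), hmem⟩ : D.side) = a from Subtype.ext hp.symm] at key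
  · rcases G.foot_subset_or_disjoint i₀ b hψ D hn hci with hside | hdis
    · have h' := h (G.newIdxH i₀ b D c hci hside)
      rw [G.piece_oldH i₀ b D (G.isOldIdxH_newIdxH i₀ b D c hci hside), oldIdxH_newIdxH, NeckCapData.inl_mem_inlSet_iff] at h'
      exact h' hc
    · exact Set.disjoint_left.1 hdis (G.P.piece_subset_foot c hc) a.2

/-- **Points of the old common part give points of the new common part.** [folklore] -/
theorem inl_mem_NH {a : D.side} (ha : (a : Q) ∈ G.P.N) : D.glueData.inl a ∈ (Hc).N := by
  rw [GluePieces.mem_N_iff]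
  intro c hc
  by_cases hco : G.IsOldIdxH i₀ b D c
  · rw [G.piece_oldH i₀ b D hco, NeckCapData.inl_mem_inlSet_iff] at hc
    exact ((GluePieces.mem_N_iff _).1 ha) _ hc
  · rcases c with i | (j | u) | k
    · exact hco trivial
    · exact hco trivial
    · rw [piece_newH] at hc
      obtain ⟨y, hy, hya⟩ := hc
      rcases eq_or_ne y 0 with rfl | hy0
      · have : D.glueData.inl a ∈ range D.glueData.inl := mem_range_self a
        rw [D.range_inl, ← hya] at this
        exact this rfl
      · have h2 := G.inr_eq_inl_tube i₀ b D hy0 hψ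
        rw [hya] at h2
        have h3 := congrArg Subtype.val (D.glueData.inl_injective h2)
        change (a : Q) = G.P.tube i₀ (unitDir (unitSpherePoint n) y, 1 / 2 + endSign b * ‖y‖) at h3
        have hy' : ‖y‖ < 1 / 2 := mem_ball_zero_iff.1 hy
        exact ((GluePieces.mem_N_iff _).1 ha) (Sum.inl i₀)
          ⟨(_, 1 / 2 + endSign b * ‖y‖), ⟨mem_univ _, halfIoo_subset b (half_add_endSign_mem_halfIoo b (norm_pos_iff.2 hy0) hy')⟩, h3.symm⟩
    · exact hco trivial

/-- **The new common part lies in the source of the transported `e`.** [folklore] -/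
theorem N_subset_sourceH (hn : n ≠ 0) : (Hc).N ⊆ (Hc).e.source := by
  intro p hp
  rw [halfCutPieces_e, NeckCapData.transport_source_eq_inlSet]
  rcases D.glueData.exists_inl_or_inr p with ⟨a, rfl⟩ | ⟨y, rfl⟩
  · exact ⟨a, G.N_subset_source (G.mem_N_of_inl_mem_NH i₀ b hψ D hn hp), rfl⟩
  · rcases lt_or_ge ‖y‖ (1 / 2) with hy | hy
    · exfalso
      rw [GluePieces.mem_N_iff] at hp
      exact hp (Sum.inr (Sum.inl (Sum.inr PUnit.unit))) (by rw [piece_newH]; exact ⟨y, mem_ball_zero_iff.2 hy, rfl⟩)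
    · have hy0 : y ≠ 0 := by rintro rfl; rw [norm_zero] at hy; norm_num at hy
      rw [G.inr_eq_inl_tube i₀ b D hy0 hψ]
      exact ⟨_, G.N_subset_source (G.tube_mem_N i₀ _ (half_add_endSign_not_mem_Ioo b hy)), rfl⟩

/-! #### Collar conditions of the cut datum -/

omit hψ in
/-- `halfCut_e_symm_image`: elementary bookkeeping (halfCut e symm image). [folklore] -/
theorem halfCut_e_symm_image {T : Set M'} (hT : T ⊆ (Hc).e.target) : (Hc).e.symm '' T = D.inlSet (G.P.e.symm '' T) := by
  rw [halfCutPieces_e] at hT ⊢; exact D.transport_symm_image hT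

omit hψ in
/-- `halfCut_target_subset`: elementary bookkeeping (halfCut target subset). [folklore] -/
theorem halfCut_target_subset : (Hc).e.target ⊆ G.P.e.target := D.transport_target_subset G.P.e

omit hψ in
/-- Tube ends (old tubes): sphere condition. [folklore] -/
theorem tubeM_sphereH (i : G.subIt i₀ D) (b' : Bool) : (Hc).tubeM i b' '' sphere 0 1 = (Hc).e '' (Hc).tubeSphere i b' := by
  change G.P.tubeM i.1 b' '' sphere 0 1 = (Hc).e '' (D.liftMap (G.P.tube i.1) _ '' (univ ×ˢ {endHeight b'}))
  rw [halfCutPieces_e, NeckCapData.transport_image_liftMap_image]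
  exact G.tubeM_sphere i.1 b'

omit hψ in
/-- `tubeM_innerH`: elementary bookkeeping (tubeM innerH). [folklore] -/
theorem tubeM_innerH (i : G.subIt i₀ D) (b' : Bool) :
    (Hc).e.symm '' ((Hc).tubeM i b' '' Metric.ball 0 1 ∩ (Hc).e.target) ⊆ (Hc).tube i '' (univ ×ˢ halfIoo b') := by
  change (Hc).e.symm '' (G.P.tubeM i.1 b' '' Metric.ball 0 1 ∩ (Hc).e.target) ⊆ D.liftMap (G.P.tube i.1) _ '' (univ ×ˢ halfIoo b')
  rw [G.halfCut_e_symm_image i₀ b D inter_subset_right, NeckCapData.image_liftMap]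
  exact D.inlSet_mono ((image_mono (inter_subset_inter_right _ (G.halfCut_target_subset i₀ b D))).trans (G.tubeM_inner i.1 b'))

/-- `tubeM_outerH`: elementary bookkeeping (tubeM outerH). [folklore] -/
theorem tubeM_outerH (i : G.subIt i₀ D) (b' : Bool) :
    (Hc).e.symm '' ((Hc).tubeM i b' '' outerAnnulus ((Hc).tubeε i b')) ⊆ (Hc).N := by
  change (Hc).e.symm '' (G.P.tubeM i.1 b' '' outerAnnulus (G.P.tubeε i.1 b')) ⊆ (Hc).N
  have hsub : G.P.tubeM i.1 b' '' outerAnnulus (G.P.tubeε i.1 b') ⊆ G.P.tubeM i.1 b' '' shell (G.P.tubeε i.1 b') (G.P.tubeδ i.1 b') :=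
    image_mono (outerAnnulus_subset_shell (G.P.tubeδ_pos i.1 b'))
  rw [G.halfCut_e_symm_image i₀ b D (hsub.trans (G.tubeM_shell_subset_targetH i₀ b D i b'))]
  rintro _ ⟨a, ha, rfl⟩
  exact G.inl_mem_NH i₀ b hψ D (G.tubeM_outer i.1 b' ha)

omit hψ in
/-- `ballM_sphereH_old`: elementary bookkeeping (ballM sphereH old). [folklore] -/
theorem ballM_sphereH_old (j : G.subIb D) : (Hc).ballM (Sum.inl j) '' sphere 0 1 = (Hc).e '' (Hc).ballSphere (Sum.inl j) := by
  change G.P.ballM j.1 '' sphere 0 1 = (Hc).e '' (D.liftMap (G.P.ball j.1) _ '' sphere 0 1)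
  rw [halfCutPieces_e, NeckCapData.transport_image_liftMap_image]
  exact G.ballM_sphere j.1

/-- **Sphere condition of the new ball**: the unit sphere of the surgery ball at the end `b` is the
image of the boundary sphere of the capped half-tube. [folklore] -/
theorem ballM_sphereH_new (u : PUnit) : (Hc).ballM (Sum.inr u) '' sphere 0 1 = (Hc).e '' (Hc).ballSphere (Sum.inr u) := by
  change G.P.tubeM i₀ b '' sphere 0 1 = (Hc).e '' (D.halfBall '' sphere 0 1)
  rw [G.image_halfBall_sphere i₀ b hψ D, halfCutPieces_e, NeckCapData.transport_image_inlSet,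
    inter_eq_left.2 (G.tubeSphere_subset_side i₀ b hψ D)]
  exact G.tubeM_sphere i₀ b

omit hψ in
/-- `ballM_innerH_old`: elementary bookkeeping (ballM innerH old). [folklore] -/
theorem ballM_innerH_old (j : G.subIb D) :
    (Hc).e.symm '' ((Hc).ballM (Sum.inl j) '' Metric.ball 0 1 ∩ (Hc).e.target) ⊆ (Hc).pieceB (Sum.inl j) := by
  change (Hc).e.symm '' (G.P.ballM j.1 '' Metric.ball 0 1 ∩ (Hc).e.target) ⊆ D.liftMap (G.P.ball j.1) _ '' Metric.ball 0 1
  rw [G.halfCut_e_symm_image i₀ b D inter_subset_right, NeckCapData.image_liftMap]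
  exact D.inlSet_mono ((image_mono (inter_subset_inter_right _ (G.halfCut_target_subset i₀ b D))).trans (G.ballM_inner j.1))

/-- **Inner condition of the new ball**: the surgery ball at the end `b` pulls back into the adjacent
half of the tube, which is the capped half-tube piece. [folklore] -/
theorem ballM_innerH_new (u : PUnit) :
    (Hc).e.symm '' ((Hc).ballM (Sum.inr u) '' Metric.ball 0 1 ∩ (Hc).e.target) ⊆ (Hc).pieceB (Sum.inr u) := by
  change (Hc).e.symm '' (G.P.tubeM i₀ b '' Metric.ball 0 1 ∩ (Hc).e.target) ⊆ D.halfBall '' Metric.ball 0 1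
  rw [G.halfCut_e_symm_image i₀ b D inter_subset_right]
  rintro _ ⟨a, ha, rfl⟩
  have ha' : (a : Q) ∈ G.P.tube i₀ '' (univ ×ˢ halfIoo b) :=
    G.tubeM_inner i₀ b ((image_mono (inter_subset_inter_right _ (G.halfCut_target_subset i₀ b D))) ha)
  obtain ⟨⟨θ, t⟩, ⟨-, ht⟩, hta⟩ := ha'
  obtain ⟨s, hs, hs', rfl⟩ := exists_of_mem_halfIoo b ht
  have hmem : G.P.tube i₀ (θ, 1 / 2 + endSign b * s) ∈ (D.side : Set Q) := by rw [hta]; exact a.2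
  have key := G.tube_half_mem_image_halfBall i₀ b hψ D hs hs' hmem
  rwa [show (⟨G.P.tube i₀ (θ, 1 / 2 + endSign b * s), hmem⟩ : D.side) = a from Subtype.ext hta] at key

/-- `ballM_outerH_old`: elementary bookkeeping (ballM outerH old). [folklore] -/
theorem ballM_outerH_old (j : G.subIb D) :
    (Hc).e.symm '' ((Hc).ballM (Sum.inl j) '' outerAnnulus ((Hc).ballε (Sum.inl j))) ⊆ (Hc).N := by
  change (Hc).e.symm '' (G.P.ballM j.1 '' outerAnnulus (G.P.ballε j.1)) ⊆ (Hc).N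
  have hsub : G.P.ballM j.1 '' outerAnnulus (G.P.ballε j.1) ⊆ G.P.ballM j.1 '' shell (G.P.ballε j.1) (G.P.ballδ j.1) :=
    image_mono (outerAnnulus_subset_shell (G.P.ballδ_pos j.1))
  rw [G.halfCut_e_symm_image i₀ b D (hsub.trans (G.ballM_shell_subset_targetH i₀ b D j))]
  rintro _ ⟨a, ha, rfl⟩
  exact G.inl_mem_NH i₀ b hψ D (G.ballM_outer j.1 ha)

/-- `ballM_outerH_new`: elementary bookkeeping (ballM outerH new). [folklore] -/
theorem ballM_outerH_new (hn : n ≠ 0) (u : PUnit) :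
    (Hc).e.symm '' ((Hc).ballM (Sum.inr u) '' outerAnnulus ((Hc).ballε (Sum.inr u))) ⊆ (Hc).N := by
  change (Hc).e.symm '' (G.P.tubeM i₀ b '' outerAnnulus (G.P.tubeε i₀ b)) ⊆ (Hc).N
  have hsub : G.P.tubeM i₀ b '' outerAnnulus (G.P.tubeε i₀ b) ⊆ G.P.tubeM i₀ b '' shell (G.P.tubeε i₀ b) (G.P.tubeδ i₀ b) :=
    image_mono (outerAnnulus_subset_shell (G.P.tubeδ_pos i₀ b))
  rw [G.halfCut_e_symm_image i₀ b D (hsub.trans (G.tubeM_end_shell_subset_targetH i₀ b hψ D hn))]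
  rintro _ ⟨a, ha, rfl⟩
  exact G.inl_mem_NH i₀ b hψ D (G.tubeM_outer i₀ b ha)

omit hψ in
/-- `mball_matchH`: elementary bookkeeping (mball matchH). [folklore] -/
theorem mball_matchH (k : G.subIm D) (x : E) (hx : x ≠ 0) :
    (Hc).mball k x ∈ (Hc).e.source ∧ (Hc).e ((Hc).mball k x) = (Hc).mballM k (radialMap ((Hc).mprof k) x) := by
  obtain ⟨h1, h2⟩ := G.mball_match k.1 x hx
  change D.liftMap (G.P.mball k.1) _ x ∈ (D.transport G.P.e).source ∧
    D.transport G.P.e (D.liftMap (G.P.mball k.1) _ x) = G.P.mballM k.1 (radialMap (G.P.mprof k.1) x)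
  rw [NeckCapData.liftMap_apply, NeckCapData.inl_mem_transport_source, NeckCapData.transport_inl]
  exact ⟨h1, h2⟩

omit hψ in
/-- `mballM_deepH`: elementary bookkeeping (mballM deepH). [folklore] -/
theorem mballM_deepH (k : G.subIm D) :
    Disjoint ((Hc).mballM k '' closedBall 0 ((Hc).mprof k (1 / 2))) ((Hc).e '' ((Hc).e.source \ (Hc).pieceM k)) := by
  change Disjoint (G.P.mballM k.1 '' closedBall 0 (G.P.mprof k.1 (1 / 2))) ((Hc).e '' ((Hc).e.source \ D.liftMap (G.P.mball k.1) _ '' Metric.ball 0 1))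
  refine (G.mballM_deep k.1).mono_right ?_
  rw [halfCutPieces_e, NeckCapData.transport_source_eq_inlSet, NeckCapData.image_liftMap]
  exact (image_mono (D.inlSet_diff_subset _ _)).trans (D.transport_image_inlSet_subset G.P.e _)

/-- **The reconstruction datum of a capped side of a middle neck** (`n ≠ 0`). [cite: Hamilton1997, §1.1 pp. 3–4] -/
def halfCut (hn : n ≠ 0) : SurgeryGlueData E n D.Capped M' where
  P := G.halfCutPieces i₀ b D
  N_subset_source := G.N_subset_sourceH i₀ b hψ D hn
  disjoint_foot := G.disjoint_foot_halfCut i₀ b hψ D hn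
  disjoint_footM' := G.disjoint_footM'_halfCut i₀ b D
  tubeM_shell i b' := G.tubeM_shell_subset_targetH i₀ b D i b'
  tubeM_sphere := G.tubeM_sphereH i₀ b D
  tubeM_inner := G.tubeM_innerH i₀ b D
  tubeM_outer := G.tubeM_outerH i₀ b hψ D
  ballM_shell j := by
    rcases j with j | u
    · exact G.ballM_shell_subset_targetH i₀ b D j
    · exact G.tubeM_end_shell_subset_targetH i₀ b hψ D hn
  ballM_sphere j := by
    rcases j with j | u
    · exact G.ballM_sphereH_old i₀ b D j
    · exact G.ballM_sphereH_new i₀ b hψ D u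
  ballM_inner j := by
    rcases j with j | u
    · exact G.ballM_innerH_old i₀ b D j
    · exact G.ballM_innerH_new i₀ b hψ D u
  ballM_outer j := by
    rcases j with j | u
    · exact G.ballM_outerH_old i₀ b hψ D j
    · exact G.ballM_outerH_new i₀ b hψ D hn u
  mball_match := G.mball_matchH i₀ b D
  mballM_deep := G.mballM_deepH i₀ b D

/-- **Cutting a tube lowers the complexity.** [folklore] -/
theorem complexity_halfCut_lt (hn : n ≠ 0) : (G.halfCut i₀ b hψ D hn).complexity < G.complexity := by
  classical
  change 3 * Fintype.card (G.subIt i₀ D) + Fintype.card (G.subIb D ⊕ PUnit) < 3 * Fintype.card G.P.It + Fintype.card G.P.Ib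
  have h1 : Fintype.card (G.subIt i₀ D) ≤ Fintype.card {i : G.P.It // ¬ i = i₀} :=
    Fintype.card_le_of_injective (fun i => ⟨i.1, i.2.1⟩) fun i i' h => Subtype.ext (congrArg Subtype.val h :)
  rw [Fintype.card_subtype_compl, Fintype.card_subtype_eq] at h1
  have h2 : Fintype.card (G.subIb D) ≤ Fintype.card G.P.Ib := Fintype.card_subtype_le _
  have h3 : 0 < Fintype.card G.P.It := Fintype.card_pos_iff.2 ⟨i₀⟩
  rw [Fintype.card_sum, Fintype.card_punit]
  omega

end HalfCut

end SurgeryGlueData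

end Literature.Topology.FourManifolds

end
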